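import Summits.QuantumFields.YangMills.Theorems.SkewnessNonGeneration.Negative.MassiveGaussianFoil
import Summits.QuantumFields.YangMills.Theorems.SkewnessNonGeneration.Negative.CompanionFree
import HarnessLib

/-!
# Route `BoundedSkewnessRunning`, crux K2 `SkewnessNonGeneration` (stmt-QuantumFields-19896):
# the typed obstruction from the massive Gaussian foil — a negative lemma modulo `H_m`

Companion of `MassiveGaussianFoil` (same seat: tribunal-w ∕ bc5-witness `ym-bc5-19897-1` g1, 2026-08-27), in the
pattern of the landed W₂ file `SelfNormalisedSkewnessFalseOfMaxwellDominatedWindowScheme` (`H → ¬ W₂`).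

`MassiveGaussianDominatedGappedScheme` (`H_m`, deliberately untagged — a hypothesis of this file, not a literature
fact, and NOT constructible in the tree): some datum meeting EXACTLY the gapped-scheme hypotheses of K2's
companion-free form (`SkewnessNonGenerationCF` of `CompanionFree.lean`: weak coupling, `0 < Δ`,
`HasLatticeMassGap`, compactly supported `u ⊆ {x₀ < 0}`, RP window) and ONE compactly supported pairwise-disjoint
triple along which `κ₃ᶜᵃⁿ_k(f,g,h)` converges to a POSITIVE multiple of a gapped-Gaussian collinear odd ring
(`αᵢ ≤ 0 < 4αᵢ + γᵢ`, `MassiveGaussianFoil.axisOddRing_neg`) — «the scale-`ξ` three-point function of `tr F²` is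
dominated by massive Gaussian 2-form exchange», the thesis' own mechanism («Gaussian domination pinned by gap»)
made precise.  Then `H_m → SkewedGappedScheme` (`skewedGappedScheme_of_massiveGaussianDominated`: the limit is
strictly negative, uniqueness of limits), hence `H_m → ¬ SkewnessNonGenerationCF` and, with K1 (under which K2
and CF are equivalent), `H_m → ¬ SkewnessNonGeneration` (`skewnessNonGeneration_false_of_massiveGaussianDominated`,
through the disprover's `skewnessNonGeneration_false_of_skewedGappedScheme`).

READING (located objection; nothing is refuted in the tree): ANY proof of K2 must show that NO admissible gapped
`SU(2)` datum is massive-Gaussian-dominated at scale `ξ` on any collinear triple — it must produce exact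
non-Gaussian cancellation of the mass-insertion terms of `MassiveGaussianFoil.massiveOddRing_eq`, i.e. the
opposite of Gaussian domination.  Intended inhabitant of `H_m`: confining `SU(2)` (AF + mass gap) read through
the Gaussian caricature; its lattice half (`HasLatticeMassGap` at `β_k → ∞`) is the open Clay-type input
(tribunal `carrier-unverified:SkewnessNonGeneration:binder:r`), so this is a negative lemma MODULO `H_m`.

Contents: `MassiveGaussianDominatedGappedScheme` (`H_m`), `skewedGappedScheme_of_massiveGaussianDominated`,
`skewnessNonGenerationCF_false_of_massiveGaussianDominated`, `skewnessNonGeneration_false_of_massiveGaussianDominated`.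
No `sorry`; axioms `propext`, `Classical.choice`, `Quot.sound`.
-/

set_option autoImplicit false

noncomputable section

open scoped BigOperators SchwartzMap Topology
open Matrix Filter MeasureTheory
open Literature.MathematicalPhysics.AQFT Literature.MathematicalPhysics.QuantumLattice
open Literature.MathematicalPhysics.QuantumFieldTheory
open Summit.QuantumFields.YangMills.Theorems.SelfNormalisedSkewness.Negative

namespace Summit.QuantumFields.YangMills.Theorems.SkewnessNonGeneration.Negative.MassiveGaussianFoil


section Obstruction

open Summit.QuantumFields.YangMills.Theses.BoundedSkewnessRunning
open Summit.QuantumFields.YangMills.Theorems.SkewnessNonGeneration.Negative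

/-- **`H_m` — a MASSIVE-GAUSSIAN-DOMINATED GAPPED SCHEME** (hypothesis of this section; NOT constructible in
the tree; deliberately untagged).  A datum `(r, sch, u, M, Δ)` meeting exactly the gapped-scheme hypotheses of
K2's companion-free form (weak coupling, `0 < Δ`, volume-uniform lattice mass gap, compactly supported `u`
in `{x₀ < 0}`, RP window) and one compactly supported pairwise-disjoint Schwartz triple `f, g, h` along which the
self-normalised skewness converges to a POSITIVE multiple `c` of a gapped-Gaussian collinear odd ring
`tr K(axisHess α₀ γ₀)K(axisHess α₁ γ₁)K(axisHess α₂ γ₂)` with radially non-increasing, strictly subharmonic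
Hessian data (`αᵢ ≤ 0 < 4αᵢ + γᵢ`) — the limit the Gaussian caricature «massive 2-form exchange at scale ξ»
predicts for non-negative bumps at three collinear points.  Intended inhabitant: confining `SU(2)` (AF +
mass gap) read through the thesis' own «Gaussian domination pinned by gap»; its lattice half
(`HasLatticeMassGap` at `β_k → ∞`) is the open Clay-type input. -/
def MassiveGaussianDominatedGappedScheme : Prop :=
  ∃ (r : LatticeRep (Matrix.specialUnitaryGroup (Fin 2) ℂ))
    (sch : SpeciesScheme (YMSpecies (Matrix.specialUnitaryGroup (Fin 2) ℂ))) (u : 𝓢(E4, ℝ)) (M Δ : ℝ)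
    (f g h : 𝓢(E4, ℝ)) (α γ : Fin 3 → ℝ) (c : ℝ),
    sch.HasWeakCouplingLimit ∧ 0 < Δ ∧ HasLatticeMassGap r sch Δ ∧
    HasCompactSupport (u : E4 → ℝ) ∧ tsupport (u : E4 → ℝ) ⊆ {y : E4 | y 0 < 0} ∧
    (∀ᶠ k in atTop, cruxT r sch u k ≤ M * cruxT r sch (timeShiftTest 4 (-1) u) k) ∧
    HasCompactSupport (f : E4 → ℝ) ∧ HasCompactSupport (g : E4 → ℝ) ∧
    HasCompactSupport (h : E4 → ℝ) ∧ Disjoint (tsupport (f : E4 → ℝ)) (tsupport (g : E4 → ℝ)) ∧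
    Disjoint (tsupport (f : E4 → ℝ)) (tsupport (h : E4 → ℝ)) ∧
    Disjoint (tsupport (g : E4 → ℝ)) (tsupport (h : E4 → ℝ)) ∧
    (∀ i, α i ≤ 0) ∧ (∀ i, 0 < 4 * α i + γ i) ∧ 0 < c ∧
    Tendsto (cruxKappa3 r sch u f g h) atTop
      (𝓝 (c * (K (axisHess (α 0) (γ 0)) * K (axisHess (α 1) (γ 1)) * K (axisHess (α 2) (γ 2))).trace))

/-- **`H_m` exhibits a skewed gapped scheme**: the limit `c·(odd ring)` is strictly negative
(`axisOddRing_neg`), so `κ₃ᶜᵃⁿ ↛ 0` on that triple. [folklore] -/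
theorem skewedGappedScheme_of_massiveGaussianDominated
    (H : MassiveGaussianDominatedGappedScheme) : SkewedGappedScheme := by
  obtain ⟨r, sch, u, M, Δ, f, g, h, α, γ, c, hw, hΔ, hgap, huc, hup, hwin, hf, hg, hh, hfg, hfh, hgh,
    hα, ht, hc, hlim⟩ := H
  refine ⟨r, sch, u, M, Δ, f, g, h, hw, hΔ, hgap, huc, hup, hwin, hf, hg, hh, hfg, hfh, hgh, ?_⟩
  intro h0
  have hneg : (K (axisHess (α 0) (γ 0)) * K (axisHess (α 1) (γ 1)) * K (axisHess (α 2) (γ 2))).trace < 0 :=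
    axisOddRing_neg (hα 0) (hα 1) (hα 2) (ht 0) (ht 1) (ht 2)
  have hcneg : c * (K (axisHess (α 0) (γ 0)) * K (axisHess (α 1) (γ 1)) * K (axisHess (α 2) (γ 2))).trace < 0 :=
    mul_neg_of_pos_of_neg hc hneg
  have heq := tendsto_nhds_unique hlim h0
  linarith

/-- **Negative lemma modulo `H_m`, companion-free form**: a massive-Gaussian-dominated gapped scheme refutes
`SkewnessNonGenerationCF`. [folklore] -/
theorem skewnessNonGenerationCF_false_of_massiveGaussianDominated
    (H : MassiveGaussianDominatedGappedScheme) : ¬ SkewnessNonGenerationCF :=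
  not_CF_iff_skewedGappedScheme.mpr (skewedGappedScheme_of_massiveGaussianDominated H)

/-- **Negative lemma modulo `H_m` for K2 itself** (given the route's other crux K1, under which K2 and its
companion-free form are equivalent): `UVSkewnessExtinction → H_m → ¬ SkewnessNonGeneration`.  Reading: any
proof of K2 must exclude massive-Gaussian domination of the scale-`ξ` curvature three-point function on every
collinear triple of every admissible gapped `SU(2)` datum — the opposite of the mechanism the thesis
advertises. [folklore] -/
theorem skewnessNonGeneration_false_of_massiveGaussianDominated (hK1 : UVSkewnessExtinction)
    (H : MassiveGaussianDominatedGappedScheme) : ¬ SkewnessNonGeneration :=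
  skewnessNonGeneration_false_of_skewedGappedScheme hK1 (skewedGappedScheme_of_massiveGaussianDominated H)

end Obstruction

end Summit.QuantumFields.YangMills.Theorems.SkewnessNonGeneration.Negative.MassiveGaussianFoil

end
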